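import Literature.AlgebraicGeometry.Resolution.MonomialOrderReduction
import Literature.AlgebraicGeometry.Resolution.MarkedIdealsArithmetic
import Literature.AlgebraicGeometry.Resolution.NonPrincipalLocus
import HarnessLib

/-!
# Crux `PatchingRelPerfect` (stmt-ResolutionOfSingularities-16161), chain w52 — R4 support:
# PRINCIPALIZATION OF A PAIR OF MONOMIAL IDEALS, part 1 (bookkeeping)

[OURS · L1 W5.2 · R4 support «monomial cleanup»] Fact-free, dimension-free tool for the two-layer
rung R4 of the crux chain (tri-1 04:21:57Z (1): the `u`-charts of the two-layer one-form process are
2-MONOMIAL ideals `(𝔞′h, u^{B+1}𝔟′)` in a simple normal crossings system, to be cleaned up by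
blowing up codimension-two strata; CHAIN v1.5 §3 «NOT covered: general monomial ideals»).  In the
vocabulary of `Resolution/MonomialMarkedIdeals.lean` (`monomialIdeal E = Π_j 𝓘_{E^j}^{a_j}` for an
exponent list `E`, `HasSNC`, `expOf`, `sheaves`) we consider TWO exponent lists `A`, `B` on the same
boundary and the ideal `monomialIdeal A ⊔ monomialIdeal B` — locally `(zᵃ, zᵇ)` in a regular system
of parameters.  This file PROVES the bookkeeping:

* `IsBadPair A B K L` / `badPairs A B` — the obstruction to principality: a divisor `K` with
  `a_K > b_K`, a divisor `L` with `a_L < b_L`, and a common point; `value`, `maxVal`, `numMax` — the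
  termination measure `(max over bad pairs of max (a_K − b_K, b_L − a_L), number of bad pairs
  attaining it)`; symmetry under `A ↔ B` (`badPairs_swap`, `maxVal_swap`, `numMax_swap`);
* `stalkIdeal_monomialIdeal_eq_finsetProd` — `(Π_j 𝓘_{E^j}^{a_j})_x = Π_{K} (𝓘_K)_x^{expOf E K}`,
  the product over the DISTINCT divisors (entries of the list with the same sheaf collected);
* `stalkIdeal_monomialIdeal_le_of_forall_expOf_le` — exponentwise comparison at the divisors
  through `x` gives containment of the stalks;
* **`isLocallyPrincipal_sup_of_badPairs_eq_empty`** — with no bad pair, `monomialIdeal A ⊔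
  monomialIdeal B` is locally principal (at each point all divisors through it compare the same way);
* `mem_support_monomialIdeal` — a divisor with positive exponent lies in the cosupport;
* `AdmitsStratumPrincipalization A B` — the conclusion of the theorem as a predicate (a `CentreSeq` with
  regular centres over the cosupport, transformed exponent lists on a common snc boundary, locally
  principal sum), its symmetry, and the trivial case `badPairs A B = ∅`.

The blow-up step is `…MonomialPairStep.lean`, the terminating induction and the theorem are in
`…MonomialPairPrincipalization.lean`.
Everything here is elementary and PROVED; no definition of the manuscript under review is used;
nothing here is a statement of it.

## References

* J. Kollár, *Lectures on Resolution of Singularities* (2007), (3.111) Step 3. [Kollar2007]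
* R. Goward, *A simple algorithm for principalization of monomial ideals*, Trans. AMS 357 (2005),
  §2. [Goward2005]
-/

-- `Summit.<Summit>.<Sub>.Theorems` with `Sub = Summit` (single-conjunct summit, D-0017)
set_option linter.dupNamespace false

noncomputable section

open CategoryTheory AlgebraicGeometry TopologicalSpace IsLocalRing
open Literature.AlgebraicGeometry.Resolution

namespace Summit.ResolutionOfSingularities.ResolutionOfSingularities.Theorems

namespace MonomialCleanup

universe u

variable {X : Scheme.{u}}

/-! ## Bad pairs and the measure -/

/-- **A bad pair of divisors** for the pair of exponent lists `(A, B)`: `K` carries more `A` than `B`,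
`L` more `B` than `A`, and `V(K) ∩ V(L) ≠ ∅` — exactly the obstruction to `(zᵃ, zᵇ)` being
principal near a common point. [folklore] -/
def IsBadPair (A B : List (X.IdealSheafData × ℕ)) (K L : X.IdealSheafData) : Prop :=
  expOf B K < expOf A K ∧ expOf A L < expOf B L ∧ ∃ x : X, x ∈ K.support ∧ x ∈ L.support

/-- The finite set of bad pairs. [folklore] -/
def badPairs (A B : List (X.IdealSheafData × ℕ)) : Finset (X.IdealSheafData × X.IdealSheafData) := by
  classical exact ((sheaves A) ×ˢ (sheaves B)).filter fun p => IsBadPair A B p.1 p.2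

/-- Membership in `badPairs`. [folklore] -/
theorem mem_badPairs_iff {A B : List (X.IdealSheafData × ℕ)} {p : X.IdealSheafData × X.IdealSheafData} :
    p ∈ badPairs A B ↔ p.1 ∈ sheaves A ∧ p.2 ∈ sheaves B ∧ IsBadPair A B p.1 p.2 := by
  classical
  simp only [badPairs, Finset.mem_filter, Finset.mem_product, and_assoc]

/-- **The value of a pair**: `max (a_K − b_K, b_L − a_L)`. [folklore] -/
def value (A B : List (X.IdealSheafData × ℕ)) (p : X.IdealSheafData × X.IdealSheafData) : ℕ :=
  max (expOf A p.1 - expOf B p.1) (expOf B p.2 - expOf A p.2)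

/-- **The maximal value of a bad pair** (`0` if there is none). [folklore] -/
def maxVal (A B : List (X.IdealSheafData × ℕ)) : ℕ :=
  (badPairs A B).sup (value A B)

/-- **The number of bad pairs of maximal value.** [folklore] -/
def numMax (A B : List (X.IdealSheafData × ℕ)) : ℕ := by
  classical exact ((badPairs A B).filter fun p => value A B p = maxVal A B).card

/-- The value of a bad pair is at most `maxVal`. [folklore] -/
theorem value_le_maxVal {A B : List (X.IdealSheafData × ℕ)} {p : X.IdealSheafData × X.IdealSheafData}
    (hp : p ∈ badPairs A B) : value A B p ≤ maxVal A B :=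
  Finset.le_sup (f := value A B) hp

/-- A bad pair has positive value. [folklore] -/
theorem value_pos {A B : List (X.IdealSheafData × ℕ)} {p : X.IdealSheafData × X.IdealSheafData}
    (hp : p ∈ badPairs A B) : 0 < value A B p := by
  obtain ⟨-, -, h1, -, -⟩ := mem_badPairs_iff.mp hp
  exact lt_max_of_lt_left (Nat.sub_pos_of_lt h1)

/-- If there is a bad pair, some bad pair attains `maxVal`, and `maxVal > 0`. [folklore] -/
theorem exists_value_eq_maxVal {A B : List (X.IdealSheafData × ℕ)} (h : (badPairs A B).Nonempty) :
    ∃ p ∈ badPairs A B, value A B p = maxVal A B := by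
  obtain ⟨p, hp, hmax⟩ := Finset.exists_mem_eq_sup (badPairs A B) h (value A B)
  exact ⟨p, hp, hmax.symm⟩

/-- With a bad pair present, `numMax ≥ 1`. [folklore] -/
theorem numMax_pos {A B : List (X.IdealSheafData × ℕ)} (h : (badPairs A B).Nonempty) :
    0 < numMax A B := by
  classical
  obtain ⟨p, hp, hpv⟩ := exists_value_eq_maxVal h
  rw [numMax, Finset.card_pos]
  exact ⟨p, Finset.mem_filter.mpr ⟨hp, hpv⟩⟩

/-! ## Symmetry `A ↔ B` -/

/-- Bad pairs are swapped when `A` and `B` are. [folklore] -/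
theorem isBadPair_swap {A B : List (X.IdealSheafData × ℕ)} {K L : X.IdealSheafData} :
    IsBadPair B A L K ↔ IsBadPair A B K L := by
  simp only [IsBadPair]
  constructor
  · rintro ⟨h1, h2, x, hxL, hxK⟩
    exact ⟨h2, h1, x, hxK, hxL⟩
  · rintro ⟨h1, h2, x, hxK, hxL⟩
    exact ⟨h2, h1, x, hxL, hxK⟩

/-- `badPairs B A` is the image of `badPairs A B` under `Prod.swap`. [folklore] -/
theorem badPairs_swap (A B : List (X.IdealSheafData × ℕ)) :
    badPairs B A = (badPairs A B).map ⟨Prod.swap, Prod.swap_injective⟩ := by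
  ext p
  rw [Finset.mem_map]
  constructor
  · intro hp
    obtain ⟨h1, h2, h3⟩ := mem_badPairs_iff.mp hp
    refine ⟨p.swap, mem_badPairs_iff.mpr ⟨h2, h1, isBadPair_swap.mp h3⟩, ?_⟩
    simp only [Function.Embedding.coeFn_mk, Prod.swap_swap]
  · rintro ⟨q, hq, rfl⟩
    obtain ⟨h1, h2, h3⟩ := mem_badPairs_iff.mp hq
    exact mem_badPairs_iff.mpr ⟨h2, h1, isBadPair_swap.mpr h3⟩

/-- The value is symmetric. [folklore] -/
theorem value_swap (A B : List (X.IdealSheafData × ℕ)) (p : X.IdealSheafData × X.IdealSheafData) :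
    value B A p.swap = value A B p := by
  simp only [value, Prod.fst_swap, Prod.snd_swap, max_comm]

/-- `maxVal` is symmetric. [folklore] -/
theorem maxVal_swap (A B : List (X.IdealSheafData × ℕ)) : maxVal B A = maxVal A B := by
  rw [maxVal, maxVal, badPairs_swap, Finset.sup_map]
  refine Finset.sup_congr rfl fun p _ => ?_
  simp only [Function.comp_apply, Function.Embedding.coeFn_mk, value_swap]

/-- `numMax` is symmetric. [folklore] -/
theorem numMax_swap (A B : List (X.IdealSheafData × ℕ)) : numMax B A = numMax A B := by
  classical
  rw [numMax, numMax, maxVal_swap, badPairs_swap, Finset.filter_map, Finset.card_map]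
  congr 1
  refine Finset.filter_congr fun p _ => ?_
  simp only [Function.comp_apply, Function.Embedding.coeFn_mk, value_swap]

/-! ## Exponent lists with the same boundary -/

/-- Equal boundaries have equal sets of divisors. [folklore] -/
theorem sheaves_eq_of_boundaryOf_eq {A B : List (X.IdealSheafData × ℕ)} (hAB : boundaryOf A = boundaryOf B) :
    sheaves A = sheaves B := by
  ext K
  rw [mem_sheaves_iff, mem_sheaves_iff, hAB]

/-- The exponent of a divisor in a cons. [folklore] -/
theorem expOf_cons (p : X.IdealSheafData × ℕ) (E : List (X.IdealSheafData × ℕ)) (K : X.IdealSheafData) :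
    expOf (p :: E) K = (by classical exact if p.1 = K then p.2 else 0) + expOf E K := by
  classical
  rw [expOf, expOf, weightOf_cons]
  simp only [Finset.mem_singleton]

/-- The exponent of a divisor not in the boundary is zero. [folklore] -/
theorem expOf_eq_zero_of_not_mem {E : List (X.IdealSheafData × ℕ)} {K : X.IdealSheafData}
    (hK : K ∉ sheaves E) : expOf E K = 0 := by
  classical
  induction E with
  | nil => simp [expOf]
  | cons p E ih =>
    rw [expOf_cons]
    have hp : p.1 ≠ K := fun h => hK (mem_sheaves_iff.mpr (h ▸ fst_mem_boundaryOf (List.mem_cons_self ..)))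
    have hK' : K ∉ sheaves E := fun h => hK (by
      rw [mem_sheaves_iff] at h ⊢
      exact List.mem_map.mpr (by
        obtain ⟨q, hq, hqK⟩ := List.mem_map.mp h
        exact ⟨q, List.mem_cons_of_mem _ hq, hqK⟩))
    rw [if_neg hp, ih hK', zero_add]

/-! ## Stalks of monomial ideals, divisor by divisor -/

/-- **`(Π_j 𝓘_{E^j}^{a_j})_x = Π_{K ∈ S} (𝓘_K)_x^{expOf E K}`** for every finite set `S` of ideal
sheaves containing the divisors of `E` (entries with the same sheaf are collected; the product is over
DISTINCT sheaves). [folklore] -/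
theorem stalkIdeal_monomialIdeal_eq_finsetProd (E : List (X.IdealSheafData × ℕ))
    {S : Finset X.IdealSheafData} (hS : sheaves E ⊆ S) (x : X) :
    stalkIdeal (monomialIdeal E) x = ∏ K ∈ S, stalkIdeal K x ^ expOf E K := by
  classical
  induction E with
  | nil =>
    rw [monomialIdeal_nil, stalkIdeal_top, ← Ideal.one_eq_top]
    symm
    refine Finset.prod_eq_one fun K _ => ?_
    rw [expOf, weightOf_nil, pow_zero]
  | cons p E ih =>
    have hpS : p.1 ∈ S := hS (mem_sheaves_iff.mpr (fst_mem_boundaryOf (List.mem_cons_self ..)))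
    have hES : sheaves E ⊆ S := fun K hK => hS (by
      rw [mem_sheaves_iff] at hK ⊢
      obtain ⟨q, hq, hqK⟩ := List.mem_map.mp hK
      exact List.mem_map.mpr ⟨q, List.mem_cons_of_mem _ hq, hqK⟩)
    rw [monomialIdeal_cons, stalkIdeal_mul, stalkIdeal_pow, ih hES]
    have hsplit : ∏ K ∈ S, stalkIdeal K x ^ expOf (p :: E) K =
        (∏ K ∈ S, stalkIdeal K x ^ (if p.1 = K then p.2 else 0)) *
          ∏ K ∈ S, stalkIdeal K x ^ expOf E K := by
      rw [← Finset.prod_mul_distrib]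
      refine Finset.prod_congr rfl fun K _ => ?_
      rw [expOf_cons, pow_add]
    have h1 : ∏ K ∈ S, stalkIdeal K x ^ (if p.1 = K then p.2 else 0) = stalkIdeal p.1 x ^ p.2 := by
      rw [Finset.prod_eq_single_of_mem p.1 hpS fun K _ hK => by rw [if_neg (Ne.symm hK), pow_zero],
        if_pos rfl]
    rw [hsplit, h1]

/-- Products of ideals over a finite set are monotone factorwise. [folklore] -/
theorem finsetProd_le_finsetProd {R : Type*} [CommSemiring R] {ι : Type*} (s : Finset ι)
    {f g : ι → Ideal R} (h : ∀ i ∈ s, f i ≤ g i) : ∏ i ∈ s, f i ≤ ∏ i ∈ s, g i := by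
  classical
  induction s using Finset.induction_on with
  | empty => simp
  | insert a s ha ih =>
    rw [Finset.prod_insert ha, Finset.prod_insert ha]
    exact Ideal.mul_mono (h a (Finset.mem_insert_self a s))
      (ih fun i hi => h i (Finset.mem_insert_of_mem hi))

/-- **Exponentwise comparison at the divisors through `x` gives containment of stalks**:
if `a_K ≤ b_K` for every divisor `K ∋ x`, then `(zᵇ) ⊆ (zᵃ)` in `𝒪_{X,x}`. [folklore] -/
theorem stalkIdeal_monomialIdeal_le_of_forall_expOf_le {A B : List (X.IdealSheafData × ℕ)}
    (hAB : boundaryOf A = boundaryOf B) (x : X)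
    (h : ∀ K ∈ sheaves A, x ∈ K.support → expOf A K ≤ expOf B K) :
    stalkIdeal (monomialIdeal B) x ≤ stalkIdeal (monomialIdeal A) x := by
  rw [stalkIdeal_monomialIdeal_eq_finsetProd A (subset_refl _) x,
    stalkIdeal_monomialIdeal_eq_finsetProd B (sheaves_eq_of_boundaryOf_eq hAB).symm.subset x]
  refine finsetProd_le_finsetProd _ fun K hK => ?_
  by_cases hx : x ∈ K.support
  · exact Ideal.pow_le_pow_right (h K hK hx)
  · rw [stalkIdeal_eq_top_of_not_mem_support hx, Ideal.top_pow, Ideal.top_pow]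

/-! ## No bad pair: the sum is locally principal -/

/-- At a point all of whose divisors satisfy `a_K ≤ b_K`, the stalk of `monomialIdeal A ⊔
monomialIdeal B` is that of `monomialIdeal A`, a principal ideal. [folklore] -/
theorem isPrincipal_stalkIdeal_sup_of_forall_expOf_le {A B : List (X.IdealSheafData × ℕ)}
    (hE : HasSNC (boundaryOf A)) (hAB : boundaryOf A = boundaryOf B) (x : X)
    (h : ∀ K ∈ sheaves A, x ∈ K.support → expOf A K ≤ expOf B K) :
    (stalkIdeal (monomialIdeal A ⊔ monomialIdeal B) x).IsPrincipal := by
  haveI : IsRegularLocalRing (X.presheaf.stalk x) := (hE x).1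
  rw [stalkIdeal_sup, sup_eq_left.mpr (stalkIdeal_monomialIdeal_le_of_forall_expOf_le hAB x h)]
  obtain ⟨g, hg, -, -⟩ := exists_generator_stalkIdeal_monomialIdeal A (x := x) fun p hp hx =>
    hE.exists_generator_of_mem (fst_mem_boundaryOf hp) hx
  exact ⟨g, hg⟩

/-- **No bad pair ⇒ `monomialIdeal A ⊔ monomialIdeal B` is locally principal**: at each point
either every divisor through it has `a_K ≤ b_K` or every one has `b_K ≤ a_K` (two divisors
comparing in opposite strict ways would be a bad pair with that common point), so the stalk of the
sum is one of the two principal monomial stalks. [folklore] -/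
theorem isLocallyPrincipal_sup_of_badPairs_eq_empty [IsLocallyNoetherian X]
    {A B : List (X.IdealSheafData × ℕ)} (hE : HasSNC (boundaryOf A)) (hAB : boundaryOf A = boundaryOf B)
    (h : badPairs A B = ∅) : IsLocallyPrincipal (monomialIdeal A ⊔ monomialIdeal B) := by
  intro x
  refine isLocallyPrincipalAt_of_isPrincipal_stalkIdeal ?_
  by_cases hA : ∀ K ∈ sheaves A, x ∈ K.support → expOf A K ≤ expOf B K
  · exact isPrincipal_stalkIdeal_sup_of_forall_expOf_le hE hAB x hA
  · push Not at hA
    obtain ⟨K, hK, hxK, hlt⟩ := hA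
    have hB : ∀ L ∈ sheaves B, x ∈ L.support → expOf B L ≤ expOf A L := by
      intro L hL hxL
      by_contra hlt'
      have hmem : (K, L) ∈ badPairs A B :=
        mem_badPairs_iff.mpr ⟨hK, hL, hlt, lt_of_not_ge hlt', x, hxK, hxL⟩
      rw [h] at hmem
      exact absurd hmem (Finset.notMem_empty _)
    rw [sup_comm]
    exact isPrincipal_stalkIdeal_sup_of_forall_expOf_le (hAB ▸ hE) hAB.symm x hB

/-! ## Cosupport -/

/-- **A divisor with positive exponent lies in the cosupport of the monomial ideal.** [folklore] -/
theorem mem_support_monomialIdeal {E : List (X.IdealSheafData × ℕ)} {K : X.IdealSheafData} {x : X}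
    (hK : K ∈ sheaves E) (hpos : expOf E K ≠ 0) (hx : x ∈ K.support) :
    x ∈ (monomialIdeal E).support := by
  classical
  rw [mem_support_iff_stalkIdeal_le] at hx ⊢
  rw [stalkIdeal_monomialIdeal_eq_finsetProd E (subset_refl _) x]
  calc ∏ L ∈ sheaves E, stalkIdeal L x ^ expOf E L
      ≤ stalkIdeal K x ^ expOf E K := (Ideal.prod_le_inf).trans (Finset.inf_le hK)
    _ ≤ stalkIdeal K x := Ideal.pow_le_self hpos
    _ ≤ _ := hx

/-- Both divisors of a bad pair have positive exponent on their heavy side, so their common points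
lie in the cosupport of `monomialIdeal A ⊔ monomialIdeal B`. [folklore] -/
theorem mem_support_sup_of_isBadPair {A B : List (X.IdealSheafData × ℕ)} {K L : X.IdealSheafData}
    (hK : K ∈ sheaves A) (hL : L ∈ sheaves B) (h : IsBadPair A B K L) {x : X}
    (hxK : x ∈ K.support) (hxL : x ∈ L.support) :
    x ∈ (monomialIdeal A ⊔ monomialIdeal B).support := by
  obtain ⟨h1, h2, -⟩ := h
  rw [Scheme.IdealSheafData.support_sup]
  exact ⟨mem_support_monomialIdeal hK (by omega) hxK, mem_support_monomialIdeal hL (by omega) hxL⟩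

/-! ## The conclusion of the principalization theorem, as a predicate -/

/-- [OURS · L1 W5.2] **`(A, B)` admits a principalization by strata**: there is a finite sequence of
blowings up (a `CentreSeq`, `BlowupSequences.lean`) with regular centres lying over the cosupport of
`monomialIdeal A ⊔ monomialIdeal B`, after which the total transforms of the two monomial ideals are the
monomial ideals of exponent lists `A'`, `B'` on a common simple normal crossings boundary and
`monomialIdeal A' ⊔ monomialIdeal B'` is locally principal. [folklore] -/
def AdmitsStratumPrincipalization {X : Scheme.{u}} (A B : List (X.IdealSheafData × ℕ)) : Prop :=
  ∃ (s : CentreSeq X) (A' B' : List (s.top.IdealSheafData × ℕ)),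
    s.AllRegular ∧ s.CentresOver ((monomialIdeal A ⊔ monomialIdeal B).support : Set X) ∧
    boundaryOf A' = boundaryOf B' ∧ HasSNC (boundaryOf A') ∧
    (monomialIdeal A).comap s.comp = monomialIdeal A' ∧
    (monomialIdeal B).comap s.comp = monomialIdeal B' ∧
    IsLocallyPrincipal (monomialIdeal A' ⊔ monomialIdeal B')

/-- The predicate is symmetric in `A`, `B`. [folklore] -/
theorem AdmitsStratumPrincipalization.symm {A B : List (X.IdealSheafData × ℕ)}
    (h : AdmitsStratumPrincipalization B A) : AdmitsStratumPrincipalization A B := by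
  obtain ⟨s, B', A', hreg, hover, hbd, hsnc, hB, hA, hlp⟩ := h
  refine ⟨s, A', B', hreg, by rwa [sup_comm] at hover, hbd.symm, hbd ▸ hsnc, hA, hB, by rwa [sup_comm] at hlp⟩

/-- **No bad pair: the empty sequence principalizes.** [folklore] -/
theorem admitsStratumPrincipalization_of_badPairs_eq_empty [IsLocallyNoetherian X]
    {A B : List (X.IdealSheafData × ℕ)} (hE : HasSNC (boundaryOf A)) (hAB : boundaryOf A = boundaryOf B)
    (hemp : badPairs A B = ∅) : AdmitsStratumPrincipalization A B := by
  have hlp := isLocallyPrincipal_sup_of_badPairs_eq_empty hE hAB hemp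
  have hA : (monomialIdeal A).comap (𝟙 X) = monomialIdeal A := Scheme.IdealSheafData.comap_id _
  have hB : (monomialIdeal B).comap (𝟙 X) = monomialIdeal B := Scheme.IdealSheafData.comap_id _
  exact ⟨CentreSeq.nil X, A, B, trivial, trivial, hAB, hE, hA, hB, hlp⟩

end MonomialCleanup

end Summit.ResolutionOfSingularities.ResolutionOfSingularities.Theorems

end
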